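import Mathlib.GroupTheory.Commensurable
import Mathlib.Topology.Algebra.OpenSubgroup
import Mathlib.Topology.Algebra.ContinuousMonoidHom
import Mathlib.NumberTheory.Padics.PadicIntegers
import Literature.AlgebraicGeometry.Frobenioids.Categories

/-!
# Profinite-group terminology of [AbsAnab] §0 and [AbsTopI] §0

The group-theoretic vocabulary in which Mochizuki's absolute anabelian results
([AbsAnab] = *The Absolute Anabelian Geometry of Hyperbolic Curves* (2004);
[AbsTopI] = *Topics in Absolute Anabelian Geometry I* (2012)) are phrased:

* `IsSlimGroup` (REUSED from `Literature.AlgebraicGeometry.Frobenioids.Categories`, [FrdI] §0 =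
  [AbsAnab] Def 0.1 (i) = [AbsTopI] §0 p. 8): centralisers of open subgroups are trivial;
* `IsRelativelySlim f` ([AbsAnab] Def 0.1 (ii)): a homomorphism `f : G → H` such that the
  centraliser in `H` of the image of every open subgroup of `G` is trivial;
* `IsCommensurablyTerminal K`, `IsNormallyTerminal K` ([AbsAnab] Def 0.1 (iii), [AbsTopI] §0
  p. 8): `C_G(K) = K`, resp. `N_G(K) = K`, with Mathlib's `Subgroup.Commensurable.commensurator`
  and `Subgroup.normalizer`;
* `IsTopologicallyFinitelyGenerated G` ([AbsTopI] §0): some finite subset generates a dense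
  subgroup;
* `freeProlRank l G` — the supremum of the `n` such that `G` surjects continuously onto `ℤ_l^n`;
  for a topologically finitely generated profinite `G` this is the number
  `δ¹_l(G) = dim_{ℚ_l} H¹(G, ℚ_l) = dim_{ℚ_l}(G^{ab} ⊗ ℚ_l)` of [AbsTopI] Thm 2.6 and of
  [AbsAnab] Lemma 1.1.4 (ii) (this identification is classical and is NOT proved here; the
  definition below is the elementary reformulation we type statements against).

PROVED here (they are "formal consequences of the definitions" in print): [AbsAnab] Remark
0.1.1 (both sentences), Remark 0.1.2 (first implication), Remark 0.1.3 (Oort's criterion).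
Deliberately NOT here: [AbsAnab] Remark 0.1.2 second implication and the [AbsTopI] §0 p. 8
remark "finite closed normal subgroups of a slim profinite group are trivial" (provable; left
for a later pass), the example of a non-closed commensurator ([AbsAnab] §0 p. 3), co-free
completions and `G^{ab-t}` ([AbsTopI] §0). Page locators refer to the author's manuscripts
(lit keys paper:url-e8f118cc205e, 45 pp; paper:url-11ac98ba15fc, 83 pp).
-/

namespace Literature.AnabelianGeometry.AbsoluteAnabelian

open Literature.AlgebraicGeometry.Frobenioids (IsSlimGroup)
open scoped Pointwise

universe u v

/-! ### Terminality ([AbsAnab] Def 0.1 (iii), Remark 0.1.2) — no topology needed -/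

section Terminality

variable {G : Type u} [Group G]

/-- [AbsAnab] Def 0.1 (iii) / [AbsTopI] §0 p. 8: a subgroup `K ⊆ G` is *commensurably terminal*
if its commensurator `C_G(K) = {g | gKg⁻¹ ∩ K has finite index in K and in gKg⁻¹}` equals `K`
(Mathlib: `Subgroup.Commensurable.commensurator`).
[cite: MochizukiAbsAnab2004, Def 0.1 (iii) p.4] -/
@[mk_iff] structure IsCommensurablyTerminal (K : Subgroup G) : Prop where
  /-- `C_G(K) = K` -/
  commensurator_eq : Subgroup.Commensurable.commensurator K = K

/-- [AbsAnab] Def 0.1 (iii) / [AbsTopI] §0 p. 8: a subgroup `K ⊆ G` is *normally terminal* if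
its normaliser `N_G(K)` equals `K`. [cite: MochizukiAbsAnab2004, Def 0.1 (iii) p.4] -/
@[mk_iff] structure IsNormallyTerminal (K : Subgroup G) : Prop where
  /-- `N_G(K) = K` -/
  normalizer_eq : Subgroup.normalizer (K : Set G) = K

/-- The normaliser is contained in the commensurator (used for [AbsAnab] Remark 0.1.2).
[folklore] -/
private theorem normalizer_le_commensurator (K : Subgroup G) :
    Subgroup.normalizer (K : Set G) ≤ Subgroup.Commensurable.commensurator K := by
  intro g hg
  have hg' := Subgroup.mem_normalizer_iff''.mp hg
  rw [Subgroup.Commensurable.commensurator_mem_iff]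
  have : ConjAct.toConjAct g • K = K := by
    ext x
    rw [Subgroup.mem_pointwise_smul_iff_inv_smul_mem, ← map_inv, ConjAct.smul_def,
      ConjAct.ofConjAct_toConjAct, inv_inv, ← hg' x]
  rw [this]

/-- [AbsAnab] Remark 0.1.2, first implication: commensurably terminal ⇒ normally terminal.
[cite: MochizukiAbsAnab2004, Rem 0.1.2 p.4] -/
theorem IsCommensurablyTerminal.isNormallyTerminal {K : Subgroup G}
    (h : IsCommensurablyTerminal K) : IsNormallyTerminal K := by
  refine ⟨le_antisymm ?_ Subgroup.le_normalizer⟩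
  calc Subgroup.normalizer (K : Set G)
      ≤ Subgroup.Commensurable.commensurator K := normalizer_le_commensurator K
    _ = K := h.commensurator_eq

end Terminality

/-! ### Slimness, topological finite generation, free pro-`l` rank -/

section Terminology

variable {G : Type u} [Group G] [TopologicalSpace G]
variable {H : Type v} [Group H] [TopologicalSpace H]

/-- [AbsAnab] Def 0.1 (ii): a continuous homomorphism of profinite groups `f : G → H` is
*relatively slim* if the centraliser in `H` of the image of every open subgroup of `G` is
trivial. (Typed for arbitrary topological groups and a bare `MonoidHom`; continuity is not
needed to state the condition.) [cite: MochizukiAbsAnab2004, Def 0.1 (ii) p.4] -/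
@[mk_iff] structure IsRelativelySlim (f : G →* H) : Prop where
  /-- centralisers in `H` of images of open subgroups of `G` are trivial -/
  centralizer_eq_bot : ∀ U : Subgroup G, IsOpen (U : Set G) →
    Subgroup.centralizer (f '' (U : Set G)) = ⊥

variable (G) in
/-- [AbsTopI] §0 (used in Prop 2.2, Thm 2.6; [AbsAnab] Thm 1.1.2, Lemma 1.1.4): a topological
group is *topologically finitely generated* if some finite subset generates a dense subgroup.
[cite: MochizukiAbsTopI2012, §0 p.8] -/
@[mk_iff] structure IsTopologicallyFinitelyGenerated [IsTopologicalGroup G] : Prop where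
  /-- a finite set whose generated subgroup is dense -/
  exists_finset : ∃ s : Finset G, (Subgroup.closure (s : Set G)).topologicalClosure = ⊤

variable (G) in
/-- The *free pro-`l` rank* of a topological group `G`: the supremum (in `ℕ∞`) of the `n : ℕ`
such that `G` admits a continuous surjective homomorphism onto `ℤ_l^n` (written
multiplicatively). For a topologically finitely generated profinite group this is the integer
`δ¹_l(G) = dim_{ℚ_l} H¹(G, ℚ_l)` of [AbsTopI] Thm 2.6, i.e. the `ℚ_l`-dimension of
`G^{ab} ⊗_Ẑ ℚ_l` appearing in [AbsAnab] Lemma 1.1.4 (ii) — an identification we record but do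
not prove. [cite: MochizukiAbsTopI2012, Thm 2.6 p.21] -/
noncomputable def freeProlRank (l : ℕ) [Fact l.Prime] : ℕ∞ :=
  ⨆ (n : ℕ) (_ : ∃ f : ContinuousMonoidHom G (Multiplicative (Fin n → ℤ_[l])),
    Function.Surjective f), (n : ℕ∞)

/-- [AbsAnab] Remark 0.1.1, first sentence: `G` is slim iff the identity `G → G` is relatively
slim. [cite: MochizukiAbsAnab2004, Rem 0.1.1 p.4] -/
theorem isSlimGroup_iff_isRelativelySlim_id :
    IsSlimGroup G ↔ IsRelativelySlim (MonoidHom.id G) := by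
  constructor
  · intro h
    refine ⟨fun U hU => ?_⟩
    simpa only [MonoidHom.id_apply, Set.image_id'] using h.centralizer_eq_bot U hU
  · intro h
    refine ⟨fun U hU => ?_⟩
    simpa only [MonoidHom.id_apply, Set.image_id'] using h.centralizer_eq_bot U hU

/-- [AbsAnab] Remark 0.1.1, second sentence, part 1: if `K ⊆ G` is a subgroup such that the
inclusion `K ↪ G` is relatively slim, then `G` is slim. (Print assumes `K` closed; not needed.)
[cite: MochizukiAbsAnab2004, Rem 0.1.1 p.4] -/
theorem isSlimGroup_of_isRelativelySlim_subtype (K : Subgroup G)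
    (h : IsRelativelySlim K.subtype) : IsSlimGroup G := by
  refine ⟨fun U hU => ?_⟩
  -- `U ∩ K` is open in `K`, and its image in `G` is contained in `U`
  have hV : IsOpen ((U.comap K.subtype : Subgroup K) : Set K) := by
    change IsOpen (K.subtype ⁻¹' (U : Set G))
    exact hU.preimage continuous_subtype_val
  have h1 := h.centralizer_eq_bot (U.comap K.subtype) hV
  rw [eq_bot_iff] at h1 ⊢
  refine le_trans (Subgroup.centralizer_le ?_) h1
  rintro _ ⟨x, hx, rfl⟩
  exact hx

/-- [AbsAnab] Remark 0.1.1, second sentence, part 2: if the inclusion `K ↪ G` is relatively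
slim, then `K` is slim. [cite: MochizukiAbsAnab2004, Rem 0.1.1 p.4] -/
theorem isSlimGroup_subgroup_of_isRelativelySlim_subtype (K : Subgroup G)
    (h : IsRelativelySlim K.subtype) : IsSlimGroup K := by
  refine ⟨fun V hV => ?_⟩
  have h1 := h.centralizer_eq_bot V hV
  rw [eq_bot_iff] at h1 ⊢
  intro k hk
  have hk' : (k : G) ∈ Subgroup.centralizer (K.subtype '' (V : Set K)) := by
    rw [Subgroup.mem_centralizer_iff]
    rintro _ ⟨v, hv, rfl⟩
    have := (Subgroup.mem_centralizer_iff.mp hk) v hv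
    simpa using congrArg Subtype.val this
  have : (k : G) = 1 := by simpa using h1 hk'
  exact Subgroup.mem_bot.mpr (Subtype.ext this)

variable [IsTopologicalGroup G]

/-- [AbsAnab] Remark 0.1.3 (pointed out by F. Oort): a topological group is slim iff every open
subgroup has trivial centre. (Print: for profinite groups; the argument — "let `H'` be the
subgroup generated by `H` and `h`; then `h` lies in the centre of `H'`" — works verbatim for any
topological group.) [cite: MochizukiAbsAnab2004, Rem 0.1.3 p.4] -/
theorem isSlimGroup_iff_forall_isOpen_center_eq_bot :
    IsSlimGroup G ↔ ∀ U : Subgroup G, IsOpen (U : Set G) → Subgroup.center U = ⊥ := by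
  constructor
  · intro h U hU
    rw [eq_bot_iff]
    intro u hu
    have hc := h.centralizer_eq_bot U hU
    have : (u : G) ∈ Subgroup.centralizer (U : Set G) := by
      rw [Subgroup.mem_centralizer_iff]
      intro v hv
      have := Subgroup.mem_center_iff.mp hu ⟨v, hv⟩
      simpa using congrArg Subtype.val this
    rw [hc] at this
    exact Subgroup.mem_bot.mpr (Subtype.ext (Subgroup.mem_bot.mp this))
  · intro h
    refine ⟨fun U hU => ?_⟩
    rw [eq_bot_iff]
    intro g hg
    -- `U' :=` the subgroup generated by `U` and `g`; it is open since it contains `U`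
    let U' : Subgroup G := U ⊔ Subgroup.zpowers g
    have hUU' : U ≤ U' := le_sup_left
    have hU'open : IsOpen (U' : Set G) := Subgroup.isOpen_mono hUU' hU
    have hgU' : g ∈ U' := (le_sup_right : Subgroup.zpowers g ≤ U') (Subgroup.mem_zpowers g)
    -- `g` is central in `U'`
    have hcomm : ∀ x ∈ U', g * x = x * g := by
      intro x hx
      refine Subgroup.closure_induction (p := fun x _ => g * x = x * g) ?_ ?_ ?_ ?_
        (show x ∈ Subgroup.closure ((U : Set G) ∪ (Subgroup.zpowers g : Set G)) by
          simpa [U', Subgroup.closure_union] using hx)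
      · rintro y (hy | hy)
        · exact ((Subgroup.mem_centralizer_iff.mp hg) y hy).symm
        · obtain ⟨k, rfl⟩ := Subgroup.mem_zpowers_iff.mp hy
          exact ((Commute.refl g).zpow_right k).eq
      · simp
      · intro a b _ _ ha hb
        rw [← mul_assoc, ha, mul_assoc, hb, mul_assoc]
      · intro a _ ha
        rw [eq_comm, inv_mul_eq_iff_eq_mul, ← mul_assoc, ← ha, mul_assoc, mul_inv_cancel,
          mul_one]
    have hcenter : (⟨g, hgU'⟩ : U') ∈ Subgroup.center U' := by
      rw [Subgroup.mem_center_iff]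
      rintro ⟨x, hx⟩
      exact Subtype.ext ((hcomm x hx).symm)
    rw [h U' hU'open] at hcenter
    exact Subgroup.mem_bot.mpr (by simpa using congrArg Subtype.val (Subgroup.mem_bot.mp hcenter))

end Terminology

end Literature.AnabelianGeometry.AbsoluteAnabelian
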